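import Summits.BirchSwinnertonDyer.BirchSwinnertonDyer.Theorems.TeichmullerTwistDescentCellsOfCDT
import Summits.BirchSwinnertonDyer.BirchSwinnertonDyer.Theorems.TeichmullerTwistDescentTwistedPeriodLatticeDichotomy
import Summits.BirchSwinnertonDyer.Rank1Residual.Additive.TypeGIntegralJ
import HarnessLib

/-!
# Route `TeichmullerTwistDescent`: the crux K `TwistedPeriodLatticeSaturation` (stmt-BirchSwinnertonDyer-25368) MODULO the printed
# Calegari–Dimitrov–Tang unbounded-denominators theorem and modularity — `--supports`

Cell `pub/bsd-wall`, seat `bsd-line-ttd-p1` (prover 1/2, g31). THEOREMS ONLY; no definition, no named fact, no `sorry`; CONDITIONAL on the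
cite-only printed facts `CalegariDimitrovTang2025_unboundedDenominators_algInt` (CDT) and `exists_isNewformOf` (modularity); the item is
not closed by name; BSD is not proved; no Manin theorem is announced (director-bsd (505)/(527)).

K = «`Λ(f) ⊆ g(χ)·Λ(f ⊗ χ)` for the optimal curve of Kodaira type II/III/IV at `p ≥ 11`» was closed CONDITIONALLY on FIVE named prints
by this line's K-files (g24–g29: CDT 1999 type, signed BDJ weight, Kraus, Edixhoven 1992, modularity — `…KOfNamedInputs`). Modulo CDT it is
two lines over the tree's own analysis of K: the LINE-11 dichotomy GRANTED modularity
(`TwistedPeriodLatticeDichotomy.stub_dichotomy_of_modularity`: index `1` OR Edixhoven's «case 1», index `p²`) and «case 1 ⟹ `p ∣ c(D)`»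
(`TwistedPeriodLatticeDichotomy.dvd_c_of_caseOne`), against `not_dvd_c_of_CDT` (p769544: `p ∤ c(D)` at every lattice-optimal datum of a
curve additive at `p ≥ 5`, modulo CDT). So ALL of the route's Manin-side statements INCLUDING K are now «modulo {CDT, modularity}»;
the (G)-ordinarity / `ord_p Δ ≤ 4` / `p ≥ 11` clauses of K are used only to feed the dichotomy's binders.
[cite: CalegariDimitrovTang2025, Thm. 1 and Remarks 58–59] [cite: EdixhovenManin1991, §4 (cases 1/2)] [cite: Stevens1989, Lemma (5.4)]
[cite: BCDTJAMS2001, Thm. A]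
-/

set_option autoImplicit false
-- single-conjunct summit: `Summit.BirchSwinnertonDyer.BirchSwinnertonDyer.…` repeats the name by design
set_option linter.dupNamespace false

noncomputable section

open scoped Classical

open WeierstrassCurve Literature.NumberTheory.EllipticCurves Literature.NumberTheory.EllipticCurves.ModularForms
  Literature.NumberTheory.EllipticCurves.Rank1Residual
  Summit.BirchSwinnertonDyer.Rank1Residual Summit.BirchSwinnertonDyer.Rank1Residual.Additive
  Summit.BirchSwinnertonDyer.BirchSwinnertonDyer.Theses.TeichmullerTwistDescent
  Summit.BirchSwinnertonDyer.BirchSwinnertonDyer.Theorems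

namespace Summit.BirchSwinnertonDyer.BirchSwinnertonDyer.Theorems.TeichmullerTwistDescent

/-- **K `TwistedPeriodLatticeSaturation` (stmt-BirchSwinnertonDyer-25368) ⟸ CDT ∧ modularity.** By the line's dichotomy granted modularity
either the saturation holds or Edixhoven's case 1 does; case 1 forces `p ∣ c(D)` (`dvd_c_of_caseOne`), which CDT refutes
(`not_dvd_c_of_CDT`). CONDITIONAL on the cite-only printed facts `hCDT`, `hnf`; the item is not closed by this; BSD is not proved by this.
[cite: CalegariDimitrovTang2025, Thm. 1 and Remarks 58–59] [cite: EdixhovenManin1991, §4] [cite: BCDTJAMS2001, Thm. A] -/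
theorem twistedPeriodLatticeSaturation_of_CDT_of_modularity
    (hCDT : Literature.NumberTheory.Automorphic.CalegariDimitrovTang2025_unboundedDenominators_algInt)
    (hnf : exists_isNewformOf) : TwistedPeriodLatticeSaturation := by
  intro W _ _ p _ _ D hsq hp11 hadd hirr hGo hV4 hopt χ hχ hprim
  rcases TwistedPeriodLatticeDichotomy.stub_dichotomy_of_modularity hnf W p D hsq hp11 hadd hirr hGo hV4 hopt χ hχ hprim
    with h | hcase
  · exact h
  · exfalso
    have hdvd : (p : ℤ) ∣ D.c :=
      TwistedPeriodLatticeDichotomy.dvd_c_of_caseOne hnf W p D hsq (by omega) hadd hirr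
        (padicValRat_j_nonneg_of_typeGOrd W p hGo) (by omega) hopt χ hχ hprim hcase
    exact not_dvd_c_of_CDT hCDT D (by omega) hadd hopt hdvd

/-- **K's registered record twin `TwistedPeriodLatticeSaturationOfNamedInputs` (stmt-BirchSwinnertonDyer-31170, closed g29) with FOUR of its
five named inputs idle, modulo CDT**: only modularity (its first binder) is used. CONDITIONAL on `hCDT`; nothing closed; BSD is not proved
by this. [cite: CalegariDimitrovTang2025, Thm. 1 and Remarks 58–59] -/
theorem twistedPeriodLatticeSaturationOfNamedInputs_of_CDT
    (hCDT : Literature.NumberTheory.Automorphic.CalegariDimitrovTang2025_unboundedDenominators_algInt) :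
    TwistedPeriodLatticeSaturationOfNamedInputs :=
  fun hnf _hT _hWt _hKr _hEd => twistedPeriodLatticeSaturation_of_CDT_of_modularity hCDT hnf

end Summit.BirchSwinnertonDyer.BirchSwinnertonDyer.Theorems.TeichmullerTwistDescent

end
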